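import Mathlib
import HarnessLib
import Summits.HubbardSuperconductivity.HubbardSuperconductivity.Theorems.KLProgrammeKLRegimeTwoLegCurvatureMSDefs
import Summits.HubbardSuperconductivity.HubbardSuperconductivity.Theorems.KLProgrammeKLRegimeSplitTwoLegSizesMSOfProfileSplit

/-!
# K3 ENGINE child (stmt-HubbardSuperconductivity-20236 `KLRegimeEngineV16`), two-leg stubs (M)/(e): the consumer of the MULTI-SLOT ANGULAR curve-jet
# predicate — `TwoLegCurveJetBoundMS … K n ⇒ TwoLegSizesMSWith / TwoLegSizesMSTQ … K n`, slot by slot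

Cell gate-hubbard-kl, seat hubbard-kl-k3c3-p3 (g5, MS lane).  Predicate: `…TwoLegCurvatureMSDefs`; single-slot case: p520144 `…TwoLegSizesMSOfCurveJet`;
memo MS-TRANSPORT.md (evidence #31 on 20236).

* §3 **`twoLegSizesMSWith_of_angularSplit`** (generic) / **`twoLegSizesMSWith_succ/zero_of_curveJetBoundMS`**: with `lp m := klFrameExtFn μ (δp m)` (the extension
  is LINEAR in the profile: `klFrameExtFn_add`, k3c3-p1's `klFrameExtFn_finset_sum`) and p520144's `norm_iteratedFDeriv_onM_klFrameExtFn_le_curveJetBar` per slot: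
  `TwoLegSizesMSWith L M β U μ K.eval n (fun j => curveJetBar (curveExtC X c) (curveExtC X c') U j n) (fun m j => e·curveExtC X R.Gfr j·uPow j U·4^{(j−2)m})`;
* §4 **`twoLegSizesMSTQ_succ/zero_of_curveJetBoundMS`**: the V15/V16 slot text under the base fit `curveExtC X c j ≤ G.S j`, `curveExtC X c' j ≤ Q.S' j` and the
  slot fit `e·curveExtC X R.Gfr j ≤ msBarQ G Q U n·R.Gfr j` (`j ≤ 4`) — fifteen closed inequalities, budget-parametric in `(c, c', e)`.

Proofs only; nothing about the model is asserted.  References: BGM 2006 §2.4 (2.36), Thm 3.1 (3.2)–(3.3) [cite: BenfattoGiulianiMastropietro2006].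
-/

noncomputable section

namespace Summit.HubbardSuperconductivity.HubbardSuperconductivity.Theorems.KLRegimeSplit

set_option linter.dupNamespace false -- summit = problem name (single-conjunct summit), D-0017

open Real Finset MeasureTheory Literature.MathematicalPhysics.QuantumLattice Literature.MathematicalPhysics.QuantumLattice.FermiRG
open Literature.Probability.LatticeModels
open Summit.HubbardSuperconductivity.HubbardSuperconductivity.Theorems.PerturbedFermiCurve

/-! ## §3 The consumer: `TwoLegSizesMSWith` slot by slot -/

section Consumer

variable {L M : ℕ} [NeZero L] [NeZero M] {G : GeoConsts} {Q : EngConsts} {R : RenConsts} {c c' : ℕ → ℝ} {e : ℝ} {β U μ : ℝ}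
  {K : TrigPolyC4v}

/-- The slot bar `e·pieceSize R U m k` IS a `curveJetBar` with constants `(e·Gfr, 0)` at scale index `m`. -/
theorem mul_pieceSize_eq_curveJetBar (e : ℝ) (R : RenConsts) (U : ℝ) (m k : ℕ) :
    e * pieceSize R U m k = curveJetBar (fun j => e * R.Gfr j) (fun _ => 0) U k m := by
  rw [pieceSize, curveJetBar_apply]; ring

/-- The extension constants of the slot bar: `curveJetBar (curveExtC X (e·Gfr)) (curveExtC X 0) U j m = e·curveExtC X R.Gfr j·uPow j U·4^{(j−2)m}`. -/
theorem curveJetBar_curveExtC_slot (X e : ℝ) (R : RenConsts) (U : ℝ) (j m : ℕ) :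
    curveJetBar (curveExtC X (fun k => e * R.Gfr k)) (curveExtC X (fun _ => 0)) U j m =
      e * curveExtC X R.Gfr j * uPow j U * (4 : ℝ) ^ (((j : ℤ) - 2) * m) := by
  rw [curveJetBar_apply, curveExtC_smul, curveExtC_zero_fun]; ring

/-- **GENERIC slot-by-slot consumer**: if `ℓ_n(K.eval) = klFrameExtFn μ δ` and `δ` splits as in `TwoLegCurveJetBoundMS` (same data, abstract `δ`), then
`TwoLegSizesMSWith L M β U μ K.eval n (base extension bars) (slot extension bars)`. -/
theorem twoLegSizesMSWith_of_angularSplit (hc : ∀ k, 0 ≤ c k) (hc' : ∀ k, 0 ≤ c' k) (he : 0 ≤ e) (hR : ∀ j, 0 ≤ R.Gfr j)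
    (hμ : μ ∈ klWindowC) {n : ℕ} {δ : ℝ → ℝ} (hP : klTwoLegPieceFn L M β U μ K.eval n = klFrameExtFn μ δ) {δp : ℕ → ℝ → ℝ}
    (hsplit : ∀ θ : ℝ, δ θ = δp n θ + ∑ m ∈ Ioc n (nScales β), δp m θ) (hsym : ∀ m, IsSymmetricProfile (δp m))
    (hbase : ∀ k ≤ 4, ∀ θ : ℝ, |iteratedDeriv k (δp n) θ| ≤ curveJetBar c c' U k n)
    (hslot : ∀ m ∈ Ioc n (nScales β), ∀ k ≤ 4, ∀ θ : ℝ, |iteratedDeriv k (δp m) θ| ≤ e * pieceSize R U m k)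
    {X : ℝ} (hX : ∀ l ≤ 4, ∀ x : ℝ, ‖iteratedFDeriv ℝ l salmhoferCutoff x‖ ≤ X) :
    TwoLegSizesMSWith L M β U μ K.eval n (fun j => curveJetBar (curveExtC X c) (curveExtC X c') U j n)
      (fun m j => e * curveExtC X R.Gfr j * uPow j U * (4 : ℝ) ^ (((j : ℤ) - 2) * m)) := by
  classical
  have hμ' := hμ
  simp only [klWindowC, Set.mem_Icc] at hμ'
  have hμ39 : -(39 / 10 : ℝ) ≤ μ := by linarith
  have hcont : ∀ m, Continuous (δp m) := fun m => (hsym m).1.continuous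
  -- the split of the piece
  have hδ : δ = fun θ => δp n θ + ∑ m ∈ Ioc n (nScales β), δp m θ := funext hsplit
  have hsumc : Continuous fun θ => ∑ m ∈ Ioc n (nScales β), δp m θ := continuous_finsetSum _ (fun m _ => hcont m)
  have hPsplit : ∀ p : Fin 2 → ℝ, klTwoLegPieceFn L M β U μ K.eval n p =
      klFrameExtFn μ (δp n) p + ∑ m ∈ Ioc n (nScales β), klFrameExtFn μ (δp m) p := by
    intro p
    rw [hP, hδ, klFrameExtFn_add μ ((hcont n).intervalIntegrable _ _) (hsumc.intervalIntegrable _ _)]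
    simp only [klFrameExtFn_finset_sum μ _ (fun m => δp m) (fun m _ => hcont m) p]
  refine ⟨fun m => klFrameExtFn μ (δp m), hPsplit, fun m => ?_, fun j hj q => ?_, fun m hm j hj q => ?_⟩
  · obtain ⟨hcd, hper, heven, hdiag⟩ := hsym m
    exact ⟨isSymmetricFrame_piece rfl hper heven hdiag hμ39, contDiff_four_onM_of_profile hcd hper hμ rfl⟩
  · obtain ⟨hcd, hper, -, -⟩ := hsym n
    exact norm_iteratedFDeriv_onM_klFrameExtFn_le_curveJetBar hc hc' hcd hper hbase hμ hX rfl hj q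
  · obtain ⟨hcd, hper, -, -⟩ := hsym m
    have hce : ∀ k, 0 ≤ (fun j => e * R.Gfr j) k := fun k => mul_nonneg he (hR k)
    have hjet : ∀ k ≤ 4, ∀ θ : ℝ, |iteratedDeriv k (δp m) θ| ≤ curveJetBar (fun j => e * R.Gfr j) (fun _ => 0) U k m :=
      fun k hk θ => (hslot m hm k hk θ).trans_eq (mul_pieceSize_eq_curveJetBar e R U m k)
    have h := norm_iteratedFDeriv_onM_klFrameExtFn_le_curveJetBar hce (fun _ => le_rfl) hcd hper hjet hμ hX rfl hj q
    rw [curveJetBar_curveExtC_slot] at h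
    exact h

/-- **(E3a-MS), budget-parametric, AT `n + 1`, FROM THE MULTI-SLOT CURVE JETS.** -/
theorem twoLegSizesMSWith_succ_of_curveJetBoundMS (hc : ∀ k, 0 ≤ c k) (hc' : ∀ k, 0 ≤ c' k) (he : 0 ≤ e) (hR : ∀ j, 0 ≤ R.Gfr j)
    (hμ : μ ∈ klWindowC) {n : ℕ} (h₁ : Continuous (klLocalPart L M β U μ K (n + 1))) (h₀ : Continuous (klLocalPart L M β U μ K n))
    (hjet : TwoLegCurveJetBoundMS L M c c' e R β U μ K (n + 1)) {X : ℝ} (hX : ∀ l ≤ 4, ∀ x : ℝ, ‖iteratedFDeriv ℝ l salmhoferCutoff x‖ ≤ X) :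
    TwoLegSizesMSWith L M β U μ K.eval (n + 1) (fun j => curveJetBar (curveExtC X c) (curveExtC X c') U j (n + 1))
      (fun m j => e * curveExtC X R.Gfr j * uPow j U * (4 : ℝ) ^ (((j : ℤ) - 2) * m)) := by
  obtain ⟨δp, hsplit, hsym, hbase, hslot⟩ := hjet
  exact twoLegSizesMSWith_of_angularSplit hc hc' he hR hμ (klTwoLegPieceFn_eval_succ_eq_ext_profile β U μ K n h₁ h₀) hsplit hsym hbase
    hslot hX

/-- **(E3a-MS), budget-parametric, AT `0`, FROM THE MULTI-SLOT CURVE JETS.** -/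
theorem twoLegSizesMSWith_zero_of_curveJetBoundMS (hc : ∀ k, 0 ≤ c k) (hc' : ∀ k, 0 ≤ c' k) (he : 0 ≤ e) (hR : ∀ j, 0 ≤ R.Gfr j)
    (hμ : μ ∈ klWindowC) (h₀ : Continuous (klLocalPart L M β U μ K 0)) (hK : Continuous fun θ => K.eval (klFermiPoint μ K θ))
    (hjet : TwoLegCurveJetBoundMS L M c c' e R β U μ K 0) {X : ℝ} (hX : ∀ l ≤ 4, ∀ x : ℝ, ‖iteratedFDeriv ℝ l salmhoferCutoff x‖ ≤ X) :
    TwoLegSizesMSWith L M β U μ K.eval 0 (fun j => curveJetBar (curveExtC X c) (curveExtC X c') U j 0)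
      (fun m j => e * curveExtC X R.Gfr j * uPow j U * (4 : ℝ) ^ (((j : ℤ) - 2) * m)) := by
  obtain ⟨δp, hsplit, hsym, hbase, hslot⟩ := hjet
  exact twoLegSizesMSWith_of_angularSplit hc hc' he hR hμ (klTwoLegPieceFn_eval_zero_eq_ext_profile β U μ K h₀ hK) hsplit hsym hbase
    hslot hX

/-! ## §4 The V15/V16 slot text under the fifteen package inequalities -/

/-- **The slot FIT**: `e·curveExtC X R.Gfr j ≤ msBarQ G Q U n·R.Gfr j` gives the slot-`m` extension bar within the V15/V16 allowance. -/
theorem slot_fit_le_msBarQ {X : ℝ} {n j : ℕ} (hfit : e * curveExtC X R.Gfr j ≤ msBarQ G Q U n * R.Gfr j) (m : ℕ) :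
    e * curveExtC X R.Gfr j * uPow j U * (4 : ℝ) ^ (((j : ℤ) - 2) * m) ≤
      msBarQ G Q U n * (R.Gfr j * uPow j U * (4 : ℝ) ^ (((j : ℤ) - 2) * m)) := by
  have h2 := uPow_nonneg' j U
  have h3 : (0 : ℝ) ≤ (4 : ℝ) ^ (((j : ℤ) - 2) * m) := zpow_nonneg (by norm_num) _
  calc e * curveExtC X R.Gfr j * uPow j U * (4 : ℝ) ^ (((j : ℤ) - 2) * m)
      = (e * curveExtC X R.Gfr j) * (uPow j U * (4 : ℝ) ^ (((j : ℤ) - 2) * m)) := by ring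
    _ ≤ (msBarQ G Q U n * R.Gfr j) * (uPow j U * (4 : ℝ) ^ (((j : ℤ) - 2) * m)) :=
        mul_le_mul_of_nonneg_right hfit (mul_nonneg h2 h3)
    _ = msBarQ G Q U n * (R.Gfr j * uPow j U * (4 : ℝ) ^ (((j : ℤ) - 2) * m)) := by ring

/-- **(E3a-MS-TQ) AT SCALE `n + 1` FROM THE MULTI-SLOT CURVE JETS — fifteen package inequalities.**  Under `TwoLegCurveJetBoundMS L M c c' e R β U μ K (n+1)`,
continuity of the two local parts, `X ≥ sup_{l≤4}‖Dˡχ₂‖`, the base fit `curveExtC X c j ≤ G.S j`, `curveExtC X c' j ≤ Q.S' j` and the slot fit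
`e·curveExtC X R.Gfr j ≤ msBarQ G Q U (n+1)·R.Gfr j` (`j ≤ 4`): `TwoLegSizesMSTQ L M G Q R β U μ K (n+1)`. -/
theorem twoLegSizesMSTQ_succ_of_curveJetBoundMS (hc : ∀ k, 0 ≤ c k) (hc' : ∀ k, 0 ≤ c' k) (he : 0 ≤ e) (hR : ∀ j, 0 ≤ R.Gfr j)
    (hμ : μ ∈ klWindowC) {n : ℕ} (h₁ : Continuous (klLocalPart L M β U μ K (n + 1))) (h₀ : Continuous (klLocalPart L M β U μ K n))
    (hjet : TwoLegCurveJetBoundMS L M c c' e R β U μ K (n + 1)) {X : ℝ} (hX : ∀ l ≤ 4, ∀ x : ℝ, ‖iteratedFDeriv ℝ l salmhoferCutoff x‖ ≤ X)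
    (hfit : ∀ j ≤ 4, curveExtC X c j ≤ G.S j) (hfit' : ∀ j ≤ 4, curveExtC X c' j ≤ Q.S' j)
    (hfitS : ∀ j ≤ 4, e * curveExtC X R.Gfr j ≤ msBarQ G Q U (n + 1) * R.Gfr j) :
    TwoLegSizesMSTQ L M G Q R β U μ K (n + 1) :=
  (twoLegSizesMSWith_succ_of_curveJetBoundMS hc hc' he hR hμ h₁ h₀ hjet hX).toMSTQ
    (fun j hj => curveJetBar_curveExtC_le_twoLegBar (hfit j hj) (hfit' j hj) U (n + 1))
    (fun m _ j hj => slot_fit_le_msBarQ (hfitS j hj) m)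

/-- **(E3a-MS-TQ) AT SCALE `0` FROM THE MULTI-SLOT CURVE JETS — fifteen package inequalities.** -/
theorem twoLegSizesMSTQ_zero_of_curveJetBoundMS (hc : ∀ k, 0 ≤ c k) (hc' : ∀ k, 0 ≤ c' k) (he : 0 ≤ e) (hR : ∀ j, 0 ≤ R.Gfr j)
    (hμ : μ ∈ klWindowC) (h₀ : Continuous (klLocalPart L M β U μ K 0)) (hK : Continuous fun θ => K.eval (klFermiPoint μ K θ))
    (hjet : TwoLegCurveJetBoundMS L M c c' e R β U μ K 0) {X : ℝ} (hX : ∀ l ≤ 4, ∀ x : ℝ, ‖iteratedFDeriv ℝ l salmhoferCutoff x‖ ≤ X)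
    (hfit : ∀ j ≤ 4, curveExtC X c j ≤ G.S j) (hfit' : ∀ j ≤ 4, curveExtC X c' j ≤ Q.S' j)
    (hfitS : ∀ j ≤ 4, e * curveExtC X R.Gfr j ≤ msBarQ G Q U 0 * R.Gfr j) :
    TwoLegSizesMSTQ L M G Q R β U μ K 0 :=
  (twoLegSizesMSWith_zero_of_curveJetBoundMS hc hc' he hR hμ h₀ hK hjet hX).toMSTQ
    (fun j hj => curveJetBar_curveExtC_le_twoLegBar (hfit j hj) (hfit' j hj) U 0)
    (fun m _ j hj => slot_fit_le_msBarQ (hfitS j hj) m)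

end Consumer

end Summit.HubbardSuperconductivity.HubbardSuperconductivity.Theorems.KLRegimeSplit

end
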